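import Literature.NumberTheory.EllipticCurves.WeierstrassPlaces
import Literature.NumberTheory.EllipticCurves.FunctionFieldTranslation
import HarnessLib

/-!
# `L`-points of a second curve over `k(V)`: specialisation, ramification, constant fibre degree

Trunk T-ELLARITH (group G16); notion `cm_endomorphisms_isogeny`. Second layer (after
`Literature.NumberTheory.EllipticCurves.WeierstrassPlaces`) of the divisor-theoretic degree route
to the named fact `Literature.AlgebraicGeometry.Motives.linearIndependent_tateModule_map` (Silverman, *AEC*, Thm. III.7.4;
see the module docstrings of `WeierstrassPlaces` and
`Literature.AlgebraicGeometry.Motives.FaltingsECProofs`). For Weierstrass curves `V, V'` with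
non-zero discriminant over an algebraically closed field `k` and the function field `L = k(V)`,
it studies the points `A ∈ V'(L)` (Mathlib `Affine.Point` of the base change of `V'` to `L`; the
generic image `φ(x, y)` of an isogeny `φ : V → V'` is one, *AEC* proof of III.6.2(c)): their
**specialisation** `A(P) ∈ V'(k) ∪ {O}` at every place `P` of `L`, the **pull-back**
`A^* : k(V') → k(V)` of a non-constant one, its **ramification indices**
`e_A(P) ≥ 1` with `v_P ∘ A^* = v_{A(P)}^{e_A(P)}`, the **fibre degrees**
`D_A(Q) = Σ_{A(P) = Q} e_A(P)`, and proves that **`D_A(Q)` does not depend on `Q`**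
(`fibreDegree_eq_fibreDegree_zero`; *AEC* Prop. II.2.6(a), `Σ_{P ∈ φ⁻¹ Q} e_φ(P) = deg φ`, here
without identifying the constant with the field degree, which is not needed downstream).

## The argument for constancy

For `t ∈ k(V') ∖ {0}`, `deg div (A^* t) = 0` on `V` (`WeierstrassPlaces.finsum_ord`) and
`ord_P(A^* t) = e_A(P) ord_{A(P)}(t)` give, after regrouping by fibres,
`Σ_Q ord_Q(t) D_A(Q) = 0` (`finsum_ord_mul_fibreDegree`). Applied to `t = x' - a`
(`div = (Q₀) + (-Q₀) - 2(O)`, `finsum_ord_xSubC_mul`) and to chords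
(`div = (Q₁) + (Q₂) + (Q₃) - 3(O)`, `finsum_ord_lineFn_mul`), this says that
`h = D_A - D_A(O)` is odd and additive on generic pairs of points of the group `V'(k)`; inserting a
generic auxiliary point (`V'(k)` is infinite) makes it additive everywhere, and an additive
function bounded below vanishes (`eq_apply_zero_of_divisor_relations`).

## Contents (all definitions are real)

* `Valuation.exists_eq_pow_of_le_one_imp`: comparable `ℤᵐ⁰`-valued valuations on a field differ
  by a positive power (the abstract ramification statement).
* Integrality and poles of `L`-points (`placeValuation_y_le_one`, `placeValuation_pole`,
  `exists_ord_eq_of_pole`: `ord_P x(A) = -2e`, `ord_P y(A) = -3e`), residues of polynomial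
  expressions (`placeValuation_aeval_le_one_and_placeRes`), `equation_placeRes`.
* **`specialize V V' P A ∈ V'.Point`** (residues of the coordinates, or `O` at a pole of `x(A)`),
  **`pointPullback h hu : k(V') →ₐ[k] k(V)`** (`A^*`, the tree's `funcAlgHom` of
  `FunctionFieldTranslation`), `exists_placeValuation_pointPullback_eq_pow`,
  **`ramificationIdx V V' P h hu = e_A(P)`**, `ord_pointPullback`
  (`ord_P(A^* t) = e_A(P) ord_{A(P)}(t)`), `finite_fibre_specialize`,
  **`fibreDegree V V' h hu Q = D_A(Q)`**, `finsum_ord_mul_fibreDegree`.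
* On `V'`: `xSubC V' a = x' - a`, `lineFn V' x₁ y₁ ℓ = y' - ℓ(x' - x₁) - y₁` and their principal
  divisors (`finsum_ord_xSubC_mul`, `finsum_ord_lineFn_mul`; the counting lemma
  `finsum_mul_eq_of_zeros`), `finite_setOf_two_nsmul_eq`,
  `eq_apply_zero_of_divisor_relations`, and **`fibreDegree_eq_fibreDegree_zero`**.

## Faithfulness

`specialize` is the value at `P` of the morphism `V → V'` which the `L`-point `A` is (a rational
map from a smooth curve extends to a morphism, *AEC* II.2.1); `pointPullback` is its `φ^*`
(II.§2); `ramificationIdx` is `e_φ(P)` in the form `ord_P(φ^* f) = e_φ(P) ord_{φP}(f)` (II.§2,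
Ex. 2.2); `fibreDegree` is `Σ_{P ∈ φ⁻¹(Q)} e_φ(P)` of Prop. II.2.6(a). Constancy in `Q` is the
content of II.2.6(a) used later; the identification with `deg φ = [k(V) : φ^* k(V')]` (the rest
of II.2.6(a)) is not proved or needed.

## References

* [SilvermanAEC2009] J. H. Silverman, *The Arithmetic of Elliptic Curves*, 2nd ed., GTM 106,
  Springer 2009: II.§1–2 (Prop. II.2.1, ramification `e_φ(P)`, Prop. II.2.6, Ex. 2.2), II.§3
  (Prop. II.3.1, Ex. II.3.5 `div (x - e)`), III.§3 (proof of Prop. III.3.4: the line through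
  `P, Q`), VII.§2 (integrality of points).
* R. Hartshorne, *Algebraic Geometry*, II.6.8–6.9 (the inputs Silverman cites for II.2.6).

## Design choices

* Generic over `k` (algebraically closed where needed) and `V V' : WeierstrassCurve.Affine k`, in
  `namespace Literature.WeierstrassFunctionField`, continuing `WeierstrassPlaces`.
* `ramificationIdx` and `fibreDegree` are attached to the coordinates `(u, w)` of an affine
  `L`-point with `u` transcendental (the non-constant points; constant points and `O` have no
  pull-back of fields).
-/

noncomputable section

open scoped Classical WithZero AddSubgroup
open scoped Polynomial.Bivariate
open Polynomial IsDedekindDomain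

universe u

namespace Literature.NumberTheory.EllipticCurves.WeierstrassFunctionField

open WeierstrassCurve

variable {k : Type u} [Field k]

/-! ## An abstract lemma: comparable discrete valuations differ by a power -/

/-- If two `ℤᵐ⁰`-valued valuations on a field satisfy `v₂ ≤ 1 → v₁ ≤ 1` and `v₂ < 1 → v₁ < 1`,
and `v₂` takes the value `exp (-1)`, then `v₁ = v₂ ^ e` for some `e ≥ 1` (the ramification
index). The valuation rings coincide (a valuation ring is maximal for domination), the units
coincide, and everything is a unit times a power of a uniformiser of `v₂`. Silverman, *AEC*,
II.§2 (`e_φ(P)`: `ord_P(φ^* t_{φP})`). [folklore] -/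
theorem Valuation.exists_eq_pow_of_le_one_imp {F : Type*} [Field F] (v₁ v₂ : Valuation F ℤᵐ⁰)
    (h₁ : ∀ t, v₂ t ≤ 1 → v₁ t ≤ 1) (h₂ : ∀ t, v₂ t < 1 → v₁ t < 1)
    (hπ : ∃ π, v₂ π = WithZero.exp (-1)) :
    ∃ e : ℕ, 0 < e ∧ ∀ t, v₁ t = v₂ t ^ e := by
  obtain ⟨π, hπ⟩ := hπ
  have hπ0 : π ≠ 0 := fun h ↦ by rw [h, map_zero] at hπ; exact WithZero.exp_ne_zero hπ.symm
  -- units of `v₂` are units of `v₁`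
  have hunit : ∀ t, v₂ t = 1 → v₁ t = 1 := by
    intro t ht
    have ht0 : t ≠ 0 := fun h ↦ by rw [h, map_zero] at ht; exact zero_ne_one ht
    refine le_antisymm (h₁ t ht.le) ?_
    have := h₁ t⁻¹ (by rw [map_inv₀, ht, inv_one])
    rw [map_inv₀, inv_le_one₀ ((Valuation.pos_iff _).mpr ht0)] at this
    exact this
  have hπ₁ : v₁ π < 1 := h₂ π (by rw [hπ, ← WithZero.exp_zero, WithZero.exp_lt_exp]; norm_num)
  have hπ₁0 : v₁ π ≠ 0 := (Valuation.ne_zero_iff _).mpr hπ0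
  set e : ℤ := -WithZero.log (v₁ π) with he
  have he0 : 0 < e := by
    rw [he, Left.neg_pos_iff, ← WithZero.log_one, WithZero.log_lt_log hπ₁0 one_ne_zero]
    exact hπ₁
  have hv₁π : v₁ π = WithZero.exp (-e) := by
    rw [he, neg_neg, WithZero.exp_log hπ₁0]
  refine ⟨e.toNat, by omega, fun t ↦ ?_⟩
  by_cases ht : t = 0
  · rw [ht, map_zero, map_zero, zero_pow (by omega)]
  -- `t = π ^ n * u` with `u` a `v₂`-unit
  set n : ℤ := -WithZero.log (v₂ t) with hn
  have hv₂t : v₂ t = WithZero.exp (-n) := by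
    rw [hn, neg_neg, WithZero.exp_log ((Valuation.ne_zero_iff _).mpr ht)]
  have hu : v₂ (t * π ^ (-n)) = 1 := by
    rw [map_mul, map_zpow₀, hv₂t, hπ, ← WithZero.exp_zsmul, ← WithZero.exp_add]
    convert WithZero.exp_zero
    simp
  have := hunit _ hu
  rw [map_mul, map_zpow₀, hv₁π, ← WithZero.exp_zsmul] at this
  have hv₁t : v₁ t = WithZero.exp (-(n * e)) := by
    have h' : v₁ t = (WithZero.exp (-n • -e))⁻¹ := eq_inv_of_mul_eq_one_left this
    rw [h', ← WithZero.exp_neg]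
    congr 1
    simp [mul_comm]
  rw [hv₁t, hv₂t, ← WithZero.exp_nsmul]
  congr 1
  have : (e.toNat : ℤ) = e := Int.toNat_of_nonneg he0.le
  rw [nsmul_eq_mul, this]
  ring

section LPoints

variable (V : WeierstrassCurve.Affine k) [V.IsElliptic]
variable (V' : WeierstrassCurve.Affine k) [V'.IsElliptic]

/-! ## Integrality and poles of `L`-points -/

variable {V V'}

omit [V'.IsElliptic] in
/-- The coefficients of `V'` over `L = k(V)` are constants, of valuation `≤ 1`. [folklore] -/
theorem placeValuation_baseChange_a_le_one (P : V.Point) :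
    placeValuation V P (V'.baseChange V.FunctionField).a₁ ≤ 1 ∧
    placeValuation V P (V'.baseChange V.FunctionField).a₂ ≤ 1 ∧
    placeValuation V P (V'.baseChange V.FunctionField).a₃ ≤ 1 ∧
    placeValuation V P (V'.baseChange V.FunctionField).a₄ ≤ 1 ∧
    placeValuation V P (V'.baseChange V.FunctionField).a₆ ≤ 1 := by
  have h : ∀ c : k, placeValuation V P (algebraMap k V.FunctionField c) ≤ 1 := fun c ↦ by
    by_cases hc : c = 0
    · simp [hc]
    · exact (placeValuation_algebraMap P hc).le
  exact ⟨h _, h _, h _, h _, h _⟩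

omit [V'.IsElliptic] in
/-- **Integrality of `y` from `x`**: for a point `(u, w)` of `V'` over `L = k(V)` and a place `P`
of `L`, `v_P(u) ≤ 1` implies `v_P(w) ≤ 1` (if `v_P(w) > 1` then `w²` strictly dominates the
other terms of the Weierstrass equation, whose right-hand side is integral).
Silverman, *AEC*, VII.§1–2 (points with integral `x` have integral `y`). [folklore] -/
theorem placeValuation_y_le_one {P : V.Point} {u w : V.FunctionField}
    (h : (V'.baseChange V.FunctionField).toAffine.Equation u w)
    (hu : placeValuation V P u ≤ 1) : placeValuation V P w ≤ 1 := by
  set v := placeValuation V P with hv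
  obtain ⟨ha₁, ha₂, ha₃, ha₄, ha₆⟩ := placeValuation_baseChange_a_le_one (V' := V') P
  by_contra hw
  push Not at hw
  have heq : w ^ 2 + (V'.baseChange V.FunctionField).a₁ * u * w +
      (V'.baseChange V.FunctionField).a₃ * w =
      u ^ 3 + (V'.baseChange V.FunctionField).a₂ * u ^ 2 +
        (V'.baseChange V.FunctionField).a₄ * u + (V'.baseChange V.FunctionField).a₆ := by
    have := h
    rw [Affine.Equation, Affine.evalEval_polynomial, sub_eq_zero] at this
    exact this
  have hw0 : 0 < v w := lt_trans zero_lt_one hw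
  -- the left-hand side has valuation `v w ^ 2`
  have hlhs : v (w ^ 2 + (V'.baseChange V.FunctionField).a₁ * u * w +
      (V'.baseChange V.FunctionField).a₃ * w) = v w ^ 2 := by
    have h1 : v ((V'.baseChange V.FunctionField).a₁ * u * w) < v (w ^ 2) := by
      rw [map_mul, map_mul, map_pow, sq]
      calc v _ * v u * v w ≤ 1 * 1 * v w := by gcongr
        _ = v w := by rw [one_mul, one_mul]
        _ < v w * v w := lt_mul_of_one_lt_left hw0 hw
    have h2 : v ((V'.baseChange V.FunctionField).a₃ * w) < v (w ^ 2) := by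
      rw [map_mul, map_pow, sq]
      calc v _ * v w ≤ 1 * v w := by gcongr
        _ = v w := one_mul _
        _ < v w * v w := lt_mul_of_one_lt_left hw0 hw
    rw [Valuation.map_add_eq_of_lt_left _ (by
      refine lt_of_lt_of_le h2 (le_of_eq ?_)
      exact (Valuation.map_add_eq_of_lt_left _ h1).symm), Valuation.map_add_eq_of_lt_left _ h1,
      map_pow]
  -- the right-hand side has valuation `≤ 1`
  have hrhs : v (u ^ 3 + (V'.baseChange V.FunctionField).a₂ * u ^ 2 +
      (V'.baseChange V.FunctionField).a₄ * u + (V'.baseChange V.FunctionField).a₆) ≤ 1 := by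
    refine (Valuation.map_add _ _ _).trans (max_le ((Valuation.map_add _ _ _).trans
      (max_le ((Valuation.map_add _ _ _).trans (max_le ?_ ?_)) ?_)) ha₆)
    · rw [map_pow]; exact pow_le_one₀ zero_le hu
    · rw [map_mul, map_pow]
      exact mul_le_one' ha₂ (pow_le_one₀ zero_le hu)
    · rw [map_mul]; exact mul_le_one' ha₄ hu
  rw [heq] at hlhs
  rw [hlhs] at hrhs
  have : 1 < v w ^ 2 := one_lt_pow₀ hw two_ne_zero
  exact absurd hrhs (not_le.mpr this)

omit [V'.IsElliptic] in
/-- **Poles**: for a point `(u, w)` of `V'` over `L` with `v_P(u) > 1`: `v_P(u)³ = v_P(w)²`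
and `v_P(w) > 1` (the terms `u³` and `w²` strictly dominate their sides of the Weierstrass
equation). Silverman, *AEC*, VII.§2 / IV.§1 (`x = z⁻²(...)`, `y = z⁻³(...)`). [folklore] -/
theorem placeValuation_pole {P : V.Point} {u w : V.FunctionField}
    (h : (V'.baseChange V.FunctionField).toAffine.Equation u w)
    (hu : 1 < placeValuation V P u) :
    placeValuation V P u ^ 3 = placeValuation V P w ^ 2 ∧ 1 < placeValuation V P w := by
  set v := placeValuation V P with hv
  obtain ⟨ha₁, ha₂, ha₃, ha₄, ha₆⟩ := placeValuation_baseChange_a_le_one (V' := V') P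
  have heq : w ^ 2 + (V'.baseChange V.FunctionField).a₁ * u * w +
      (V'.baseChange V.FunctionField).a₃ * w =
      u ^ 3 + (V'.baseChange V.FunctionField).a₂ * u ^ 2 +
        (V'.baseChange V.FunctionField).a₄ * u + (V'.baseChange V.FunctionField).a₆ := by
    have := h
    rw [Affine.Equation, Affine.evalEval_polynomial, sub_eq_zero] at this
    exact this
  have hu0 : 0 < v u := lt_trans zero_lt_one hu
  -- the right-hand side has valuation `v u ^ 3`
  have hrhs : v (u ^ 3 + (V'.baseChange V.FunctionField).a₂ * u ^ 2 +
      (V'.baseChange V.FunctionField).a₄ * u + (V'.baseChange V.FunctionField).a₆) = v u ^ 3 := by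
    have hu2 : v u ^ 2 < v u ^ 3 := pow_lt_pow_right₀ hu (by norm_num)
    have hu1 : v u < v u ^ 3 := by
      calc v u = v u ^ 1 := (pow_one _).symm
        _ < v u ^ 3 := pow_lt_pow_right₀ hu (by norm_num)
    have h1 : v ((V'.baseChange V.FunctionField).a₂ * u ^ 2) < v (u ^ 3) := by
      rw [map_mul, map_pow, map_pow]
      exact lt_of_le_of_lt (mul_le_of_le_one_left zero_le ha₂) hu2
    have h2 : v ((V'.baseChange V.FunctionField).a₄ * u) < v (u ^ 3) := by
      rw [map_mul, map_pow]
      exact lt_of_le_of_lt (mul_le_of_le_one_left zero_le ha₄) hu1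
    have h3 : v (V'.baseChange V.FunctionField).a₆ < v (u ^ 3) := by
      rw [map_pow]
      exact lt_of_le_of_lt ha₆ (one_lt_pow₀ hu three_ne_zero)
    have e1 : v (u ^ 3 + (V'.baseChange V.FunctionField).a₂ * u ^ 2) = v (u ^ 3) :=
      Valuation.map_add_eq_of_lt_left _ h1
    have e2 : v (u ^ 3 + (V'.baseChange V.FunctionField).a₂ * u ^ 2 +
        (V'.baseChange V.FunctionField).a₄ * u) = v (u ^ 3) := by
      rw [Valuation.map_add_eq_of_lt_left _ (by rw [e1]; exact h2), e1]
    rw [Valuation.map_add_eq_of_lt_left _ (by rw [e2]; exact h3), e2, map_pow]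
  -- hence `v w > v u`
  have hwu : v u < v w := by
    by_contra hle
    push Not at hle
    have hlhs : v (w ^ 2 + (V'.baseChange V.FunctionField).a₁ * u * w +
        (V'.baseChange V.FunctionField).a₃ * w) ≤ v u ^ 2 := by
      refine (Valuation.map_add _ _ _).trans (max_le ((Valuation.map_add _ _ _).trans
        (max_le ?_ ?_)) ?_)
      · rw [map_pow]; exact pow_le_pow_left₀ zero_le hle 2
      · rw [map_mul, map_mul, sq]
        calc v _ * v u * v w ≤ 1 * v u * v u := by gcongr
          _ = v u * v u := by rw [one_mul]
      · rw [map_mul, sq]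
        calc v _ * v w ≤ 1 * v u := by gcongr
          _ = v u := one_mul _
          _ ≤ v u * v u := le_mul_of_one_le_left zero_le hu.le
    rw [heq, hrhs] at hlhs
    exact absurd hlhs (not_le.mpr (pow_lt_pow_right₀ hu (by norm_num)))
  have hw : 1 < v w := lt_trans hu hwu
  have hw0 : 0 < v w := lt_trans zero_lt_one hw
  -- and the left-hand side has valuation `v w ^ 2`
  have hlhs : v (w ^ 2 + (V'.baseChange V.FunctionField).a₁ * u * w +
      (V'.baseChange V.FunctionField).a₃ * w) = v w ^ 2 := by
    have h1 : v ((V'.baseChange V.FunctionField).a₁ * u * w) < v (w ^ 2) := by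
      rw [map_mul, map_mul, map_pow, sq]
      calc v _ * v u * v w ≤ 1 * v u * v w := by gcongr
        _ = v u * v w := by rw [one_mul]
        _ < v w * v w := mul_lt_mul_of_pos_right hwu hw0
    have h2 : v ((V'.baseChange V.FunctionField).a₃ * w) < v (w ^ 2) := by
      rw [map_mul, map_pow, sq]
      calc v _ * v w ≤ 1 * v w := by gcongr
        _ = v w := one_mul _
        _ < v w * v w := lt_mul_of_one_lt_left hw0 hw
    have e1 : v (w ^ 2 + (V'.baseChange V.FunctionField).a₁ * u * w) = v (w ^ 2) :=
      Valuation.map_add_eq_of_lt_left _ h1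
    rw [Valuation.map_add_eq_of_lt_left _ (by rw [e1]; exact h2), e1, map_pow]
  rw [heq, hrhs] at hlhs
  exact ⟨hlhs, hw⟩

omit [V'.IsElliptic] in
/-- At a pole, `ord_P(u) = -2e` and `ord_P(w) = -3e` for some `e ≥ 1`. Silverman, *AEC*, IV.§1,
VII.§2. [folklore] -/
theorem exists_ord_eq_of_pole {P : V.Point} {u w : V.FunctionField}
    (h : (V'.baseChange V.FunctionField).toAffine.Equation u w)
    (hu : 1 < placeValuation V P u) :
    ∃ e : ℕ, 0 < e ∧ ord V P u = -(2 * e : ℤ) ∧ ord V P w = -(3 * e : ℤ) := by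
  obtain ⟨h32, hw⟩ := placeValuation_pole h hu
  have hu0 : u ≠ 0 := fun h0 ↦ by rw [h0, map_zero] at hu; exact not_lt_zero hu
  have hw0 : w ≠ 0 := fun h0 ↦ by rw [h0, map_zero] at hw; exact not_lt_zero hw
  rw [placeValuation_eq_exp_neg_ord P hu0, placeValuation_eq_exp_neg_ord P hw0,
    ← WithZero.exp_nsmul, ← WithZero.exp_nsmul, WithZero.exp_inj] at h32
  rw [placeValuation_eq_exp_neg_ord P hu0, ← WithZero.exp_zero, WithZero.exp_lt_exp] at hu
  rw [smul_neg, smul_neg, neg_inj, nsmul_eq_mul, nsmul_eq_mul] at h32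
  push_cast at h32
  refine ⟨(ord V P u - ord V P w).toNat, by omega, by omega, by omega⟩

/-! ## Residues of polynomial expressions -/

/-- **Integrality and residue of polynomial expressions**: for `wᵢ ∈ L` with `v_P(wᵢ) ≤ 1` and a
polynomial `g` over `k`, `g(w)` is integral at `P` with residue `g(res w)`. [folklore] -/
theorem placeValuation_aeval_le_one_and_placeRes {n : ℕ} (P : V.Point)
    {w : Fin n → V.FunctionField} (hw : ∀ i, placeValuation V P (w i) ≤ 1)
    (g : MvPolynomial (Fin n) k) :
    placeValuation V P (MvPolynomial.aeval w g) ≤ 1 ∧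
      placeRes V P (MvPolynomial.aeval w g) = MvPolynomial.eval (fun i ↦ placeRes V P (w i)) g := by
  induction g using MvPolynomial.induction_on with
  | C a =>
    simp only [MvPolynomial.algHom_C, MvPolynomial.eval_C]
    refine ⟨?_, placeRes_algebraMap P a⟩
    by_cases ha : a = 0
    · simp [ha]
    · exact (placeValuation_algebraMap P ha).le
  | add p q hp hq =>
    simp only [map_add]
    exact ⟨(Valuation.map_add _ _ _).trans (max_le hp.1 hq.1),
      by rw [placeRes_add P hp.1 hq.1, hp.2, hq.2]⟩
  | mul_X p i hp =>
    simp only [map_mul, MvPolynomial.aeval_X, MvPolynomial.eval_X]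
    exact ⟨mul_le_one' hp.1 (hw i), by rw [placeRes_mul P hp.1 (hw i), hp.2]⟩

/-- Bivariate version: `p(u, w)` for `p ∈ k[X][Y]` is integral with residue `p(res u, res w)`.
[folklore] -/
theorem placeValuation_aevalAeval_le_one_and_placeRes (P : V.Point) {u w : V.FunctionField}
    (hu : placeValuation V P u ≤ 1) (hw : placeValuation V P w ≤ 1) (p : k[X][Y]) :
    placeValuation V P (aevalAeval u w p) ≤ 1 ∧
      placeRes V P (aevalAeval u w p) = p.evalEval (placeRes V P u) (placeRes V P w) := by
  have hfin : ∀ i, placeValuation V P (![u, w] i) ≤ 1 := by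
    intro i; fin_cases i <;> assumption
  have := placeValuation_aeval_le_one_and_placeRes P hfin
    (Polynomial.Bivariate.equivMvPolynomial k p)
  have hfun : (fun i ↦ placeRes V P (![u, w] i)) = ![placeRes V P u, placeRes V P w] := by
    funext i; fin_cases i <;> rfl
  rwa [← aevalAeval_equivMvPolynomial_symm, AlgEquiv.symm_apply_apply, hfun,
    WeierstrassCurve.eval_eq_evalEval_equivMvPolynomial_symm, AlgEquiv.symm_apply_apply] at this

/-! ## Specialisation of `L`-points at a place -/

omit [V.IsElliptic] [V'.IsElliptic] in
/-- The Weierstrass polynomial of `V'` over `L` is that of `V'` with coefficients mapped.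
[folklore] -/
theorem baseChange_functionField_polynomial :
    (V'.baseChange V.FunctionField).toAffine.polynomial =
      V'.polynomial.map (mapRingHom (algebraMap k V.FunctionField)) :=
  Affine.map_polynomial (W := V') (algebraMap k V.FunctionField)

omit [V'.IsElliptic] in
/-- **Residues of an integral `L`-point give a point of `V'(k)`** (the Weierstrass polynomial has
constant coefficients, and the residue map is a ring homomorphism on integral elements).
[folklore] -/
theorem equation_placeRes {P : V.Point} {u w : V.FunctionField}
    (h : (V'.baseChange V.FunctionField).toAffine.Equation u w)
    (hu : placeValuation V P u ≤ 1) : V'.Equation (placeRes V P u) (placeRes V P w) := by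
  have hw := placeValuation_y_le_one h hu
  have h0 : aevalAeval u w V'.polynomial = 0 := by
    rw [aevalAeval_eq_evalEval_map', ← baseChange_functionField_polynomial]; exact h
  have := (placeValuation_aevalAeval_le_one_and_placeRes P hu hw V'.polynomial).2
  rw [h0, ← (algebraMap k V.FunctionField).map_zero, placeRes_algebraMap] at this
  exact this.symm

variable (V V') in
/-- **The specialisation `A(P) ∈ V'(k)` of an `L`-point `A` of `V'` at a place `P` of `L`**:
`O` for `A = O`; for `A = (u, w)`, the point `(u(P), w(P))` of residues if `u` is integral at
`P`, and `O` if `u` has a pole at `P`. (The reduction of `A` modulo the place `P`; for the generic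
image of a morphism `φ : V → V'` it is the value `φ(P)`.) Silverman, *AEC*, II.§2 (a rational
map from a smooth curve is defined at every point, Prop. II.2.1), VII.§2. [folklore] -/
def specialize (P : V.Point) : (V'.baseChange V.FunctionField).toAffine.Point → V'.Point
  | .zero => 0
  | .some u w h =>
    if hu : placeValuation V P u ≤ 1 then
      .some (placeRes V P u) (placeRes V P w)
        ((Affine.equation_iff_nonsingular).mp (equation_placeRes h.left hu))
    else 0

/-- `O` specialises to `O`. [folklore] -/
theorem specialize_zero (P : V.Point) :
    specialize V V' P (0 : (V'.baseChange V.FunctionField).toAffine.Point) = 0 := rfl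

/-- Specialisation at a place where `x(A)` is integral. [folklore] -/
theorem specialize_some_of_le_one (P : V.Point) {u w : V.FunctionField}
    (h : (V'.baseChange V.FunctionField).toAffine.Nonsingular u w)
    (hu : placeValuation V P u ≤ 1) :
    specialize V V' P (.some u w h) = .some (placeRes V P u) (placeRes V P w)
      ((Affine.equation_iff_nonsingular).mp (equation_placeRes h.left hu)) := by
  rw [specialize, dif_pos hu]

/-- Specialisation at a pole of `x(A)`. [folklore] -/
theorem specialize_some_of_one_lt (P : V.Point) {u w : V.FunctionField}
    (h : (V'.baseChange V.FunctionField).toAffine.Nonsingular u w)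
    (hu : 1 < placeValuation V P u) : specialize V V' P (.some u w h) = 0 := by
  rw [specialize, dif_neg (not_le.mpr hu)]

/-- `A(P) = O` iff `x(A)` has a pole at `P` (for `A ≠ O`). [folklore] -/
theorem specialize_some_eq_zero_iff (P : V.Point) {u w : V.FunctionField}
    (h : (V'.baseChange V.FunctionField).toAffine.Nonsingular u w) :
    specialize V V' P (.some u w h) = 0 ↔ 1 < placeValuation V P u := by
  by_cases hu : placeValuation V P u ≤ 1
  · rw [specialize_some_of_le_one P h hu]
    simp only [not_lt.mpr hu, iff_false]
    exact Affine.Point.some_ne_zero _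
  · push Not at hu
    simp [specialize_some_of_one_lt P h hu, hu]

/-! ## The pull-back `A^* : k(V') → k(V)` of a non-constant `L`-point and its ramification -/

/-- **The pull-back `A^* : k(V') →ₐ[k] k(V)` along a non-constant `L`-point `A = (u, w)` of
`V'`** (`u` transcendental over `k`): the point map of `(u, w)` extended to the function field
(`funcAlgHom`). For the generic image of a morphism `φ : V → V'` this is `φ^*`.
Silverman, *AEC*, II.§2. [folklore] -/
def pointPullback {u w : V.FunctionField}
    (h : (V'.baseChange V.FunctionField).toAffine.Equation u w)
    (hu : Transcendental k u) : V'.FunctionField →ₐ[k] V.FunctionField :=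
  funcAlgHom (V := V') u w (by rw [← baseChange_functionField_polynomial]; exact h) hu

omit [V.IsElliptic] [V'.IsElliptic] in
/-- `A^*` is injective (a map of fields). [folklore] -/
theorem pointPullback_injective {u w : V.FunctionField}
    (h : (V'.baseChange V.FunctionField).toAffine.Equation u w) (hu : Transcendental k u) :
    Function.Injective (pointPullback h hu) :=
  (pointPullback h hu).toRingHom.injective

omit [V.IsElliptic] [V'.IsElliptic] in
/-- `A^*` on a regular function `g(x', y')` is `g(u, w)`. [folklore] -/
theorem pointPullback_algebraMap {u w : V.FunctionField}
    (h : (V'.baseChange V.FunctionField).toAffine.Equation u w) (hu : Transcendental k u)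
    (p : k[X][Y]) : pointPullback h hu (algebraMap V'.CoordinateRing V'.FunctionField
      (Affine.CoordinateRing.mk V' p)) = aevalAeval u w p := by
  rw [pointPullback, funcAlgHom_algebraMap, pointAlgHom_mk, ← aevalAeval_eq_evalEval_map']

omit [V.IsElliptic] [V'.IsElliptic] in
/-- `A^* x' = u`. [folklore] -/
theorem pointPullback_xF {u w : V.FunctionField}
    (h : (V'.baseChange V.FunctionField).toAffine.Equation u w) (hu : Transcendental k u) :
    pointPullback h hu (xF V') = u :=
  funcAlgHom_xF _ _ _ hu

omit [V.IsElliptic] [V'.IsElliptic] in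
/-- `A^* y' = w`. [folklore] -/
theorem pointPullback_yF {u w : V.FunctionField}
    (h : (V'.baseChange V.FunctionField).toAffine.Equation u w) (hu : Transcendental k u) :
    pointPullback h hu (yF V') = w :=
  funcAlgHom_yF _ _ _ hu

omit [V'.IsElliptic] in
/-- Pull-backs of regular functions are integral at places of affine specialisation, with residue
the value at the specialisation. [folklore] -/
theorem placeValuation_pointPullback_algebraMap_of_le_one (P : V.Point) {u w : V.FunctionField}
    (h : (V'.baseChange V.FunctionField).toAffine.Equation u w) (hu : Transcendental k u)
    (hint : placeValuation V P u ≤ 1) (n : V'.CoordinateRing) :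
    placeValuation V P (pointPullback h hu (algebraMap V'.CoordinateRing V'.FunctionField n)) ≤ 1 ∧
      placeRes V P (pointPullback h hu (algebraMap V'.CoordinateRing V'.FunctionField n)) =
        pointEval (equation_placeRes h hint) n := by
  obtain ⟨p, rfl⟩ := Ideal.Quotient.mk_surjective n
  change placeValuation V P (pointPullback h hu (algebraMap V'.CoordinateRing V'.FunctionField
      (Affine.CoordinateRing.mk V' p))) ≤ 1 ∧ placeRes V P (pointPullback h hu
      (algebraMap V'.CoordinateRing V'.FunctionField (Affine.CoordinateRing.mk V' p))) =
      pointEval (equation_placeRes h hint) (Affine.CoordinateRing.mk V' p)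
  rw [pointPullback_algebraMap, pointEval_mk]
  exact placeValuation_aevalAeval_le_one_and_placeRes P hint (placeValuation_y_le_one h hint) p

omit [V'.IsElliptic] in
/-- `k[V'] → k(V')` sends `p + q y` to `p(x) + q(x) y`. [folklore] -/
theorem algebraMap_smul_basis (p q : k[X]) :
    algebraMap V'.CoordinateRing V'.FunctionField (p • (1 : V'.CoordinateRing) +
      q • Affine.CoordinateRing.mk V' Y) = aeval (xF V') p + aeval (xF V') q * yF V' := by
  rw [map_add, Algebra.smul_def, Algebra.smul_def, mul_one, map_mul,
    ← IsScalarTower.algebraMap_apply, ← IsScalarTower.algebraMap_apply,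
    algebraMap_polynomial_eq_aeval V' p, algebraMap_polynomial_eq_aeval V' q]
  rfl

/-- From `(N : WithBot ℕ) = max a b` with natural `a, b` to `N = max a b`. [folklore] -/
theorem nat_eq_max_of_withBot {N a b : ℕ}
    (h : (N : WithBot ℕ) = max (a : WithBot ℕ) (b : WithBot ℕ)) :
    N = max a b := by
  rcases le_total a b with hab | hab
  · rw [max_eq_right (by exact_mod_cast hab : (a : WithBot ℕ) ≤ b)] at h
    rw [max_eq_right hab]
    exact_mod_cast h
  · rw [max_eq_left (by exact_mod_cast hab : (b : WithBot ℕ) ≤ a)] at h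
    rw [max_eq_left hab]
    exact_mod_cast h

omit [V'.IsElliptic] in
/-- `deg N(p + q y)` as a natural number. [folklore] -/
theorem normDeg_smul_basis_eq (p q : k[X]) (h : p ≠ 0 ∨ q ≠ 0) :
    normDeg V' (p • (1 : V'.CoordinateRing) + q • Affine.CoordinateRing.mk V' Y) =
      if q = 0 then 2 * p.natDegree else if p = 0 then 2 * q.natDegree + 3
        else max (2 * p.natDegree) (2 * q.natDegree + 3) := by
  have hne : p • (1 : V'.CoordinateRing) + q • Affine.CoordinateRing.mk V' Y ≠ 0 := by
    intro h0
    have := Affine.CoordinateRing.smul_basis_eq_zero h0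
    tauto
  have key := normDeg_smul_basis (V := V') hne
  have hbot3 : 2 • (⊥ : WithBot ℕ) + 3 = ⊥ := by
    rw [two_nsmul, WithBot.bot_add, WithBot.bot_add]
  have hbot : 2 • (⊥ : WithBot ℕ) = ⊥ := by rw [two_nsmul, WithBot.bot_add]
  have hcoe : ∀ n : ℕ, 2 • ((n : ℕ) : WithBot ℕ) = ((2 * n : ℕ) : WithBot ℕ) := fun n ↦ by
    rw [two_nsmul, two_mul]; norm_cast
  have hcoe3 : ∀ n : ℕ, 2 • ((n : ℕ) : WithBot ℕ) + 3 = ((2 * n + 3 : ℕ) : WithBot ℕ) := fun n ↦ by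
    rw [hcoe]; norm_cast
  rcases eq_or_ne q 0 with rfl | hq
  · have hp : p ≠ 0 := by tauto
    rw [if_pos rfl]
    rw [degree_zero, degree_eq_natDegree hp, hcoe, hbot3, max_bot_right] at key
    exact_mod_cast key
  · rcases eq_or_ne p 0 with rfl | hp
    · rw [if_neg hq, if_pos rfl]
      rw [degree_zero, degree_eq_natDegree hq, hbot, hcoe3, max_bot_left] at key
      exact_mod_cast key
    · rw [if_neg hq, if_neg hp]
      rw [degree_eq_natDegree hp, degree_eq_natDegree hq, hcoe, hcoe3] at key
      exact nat_eq_max_of_withBot key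

omit [V'.IsElliptic] in
/-- **Pull-backs at a pole**: if `x(A)` has a pole of order `2e` at `P` (so `y(A)` one of order
`3e`), then `v_P(A^* n) = exp (e · deg N(n))` for `n ∈ k[V'] ∖ {0}`: the two terms `p(u)` and
`q(u) w` of `A^*(p + q y)` have valuations `exp (2e deg p)` and `exp (2e deg q + 3e)`, of
different parity. [folklore] -/
theorem placeValuation_pointPullback_algebraMap_of_pole (P : V.Point) {u w : V.FunctionField}
    (h : (V'.baseChange V.FunctionField).toAffine.Equation u w) (hu : Transcendental k u)
    {e : ℕ} (heu : placeValuation V P u = WithZero.exp (2 * e : ℤ))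
    (hew : placeValuation V P w = WithZero.exp (3 * e : ℤ)) (he : 0 < e)
    {n : V'.CoordinateRing} (hn : n ≠ 0) :
    placeValuation V P (pointPullback h hu (algebraMap V'.CoordinateRing V'.FunctionField n)) =
      WithZero.exp ((e * normDeg V' n : ℕ) : ℤ) := by
  set v := placeValuation V P with hv
  haveI : v.IsTrivialOn k := inferInstanceAs ((placeValuation V P).IsTrivialOn k)
  obtain ⟨p, q, rfl⟩ := Affine.CoordinateRing.exists_smul_basis_eq n
  have hpq : p ≠ 0 ∨ q ≠ 0 := by
    by_contra h0
    push Not at h0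
    exact hn (by rw [h0.1, h0.2, zero_smul, zero_smul, add_zero])
  have hu1 : 1 < v u := by
    rw [heu, ← WithZero.exp_zero, WithZero.exp_lt_exp]; positivity
  rw [algebraMap_smul_basis, map_add, map_mul, ← aeval_algHom_apply, ← aeval_algHom_apply,
    pointPullback_xF, pointPullback_yF, normDeg_smul_basis_eq p q hpq]
  have hp : p ≠ 0 → v (aeval u p) = WithZero.exp ((2 * e * p.natDegree : ℕ) : ℤ) := fun hp ↦ by
    rw [valuation_aeval_eq_valuation_X_pow_natDegree_of_one_lt_valuation_X u hu1 hp, heu,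
      ← WithZero.exp_nsmul]
    congr 1; push_cast; ring
  have hq : q ≠ 0 → v (aeval u q * w) = WithZero.exp ((2 * e * q.natDegree + 3 * e : ℕ) : ℤ) :=
    fun hq ↦ by
    rw [map_mul, valuation_aeval_eq_valuation_X_pow_natDegree_of_one_lt_valuation_X u hu1 hq,
      heu, hew, ← WithZero.exp_nsmul, ← WithZero.exp_add]
    congr 1; push_cast; ring
  by_cases hq0 : q = 0
  · have hp0 : p ≠ 0 := hpq.resolve_right (not_not.mpr hq0)
    rw [hq0, map_zero, zero_mul, add_zero, if_pos rfl, hp hp0]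
    congr 1; push_cast; ring
  · by_cases hp0 : p = 0
    · rw [hp0, map_zero, zero_add, if_neg hq0, if_pos rfl, hq hq0]
      congr 1; push_cast; ring
    · rw [if_neg hq0, if_neg hp0]
      have hne : v (aeval u p) ≠ v (aeval u q * w) := by
        rw [hp hp0, hq hq0, Ne, WithZero.exp_inj, Nat.cast_inj]
        intro heq
        have : 2 * p.natDegree = 2 * q.natDegree + 3 := Nat.eq_of_mul_eq_mul_left he (by
          calc e * (2 * p.natDegree) = 2 * e * p.natDegree := by ring
            _ = 2 * e * q.natDegree + 3 * e := heq
            _ = e * (2 * q.natDegree + 3) := by ring)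
        omega
      rcases hne.lt_or_gt with hlt | hlt
      · rw [Valuation.map_add_eq_of_lt_right _ hlt, hq hq0]
        rw [hp hp0, hq hq0, WithZero.exp_lt_exp, Nat.cast_lt] at hlt
        congr 1
        have hlt' : 2 * p.natDegree < 2 * q.natDegree + 3 := Nat.lt_of_mul_lt_mul_left (a := e) (by
          calc e * (2 * p.natDegree) = 2 * e * p.natDegree := by ring
            _ < 2 * e * q.natDegree + 3 * e := hlt
            _ = e * (2 * q.natDegree + 3) := by ring)
        rw [max_eq_right hlt'.le]; push_cast; ring
      · rw [Valuation.map_add_eq_of_lt_left _ hlt, hp hp0]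
        rw [hp hp0, hq hq0, WithZero.exp_lt_exp, Nat.cast_lt] at hlt
        congr 1
        have hlt' : 2 * q.natDegree + 3 < 2 * p.natDegree := Nat.lt_of_mul_lt_mul_left (a := e) (by
          calc e * (2 * q.natDegree + 3) = 2 * e * q.natDegree + 3 * e := by ring
            _ < 2 * e * p.natDegree := hlt
            _ = e * (2 * p.natDegree) := by ring)
        rw [max_eq_left hlt'.le]; push_cast; ring

/-- **The ramification comparison `v_P ∘ A^* = v_{A(P)} ^ e`**: for a non-constant `L`-point
`A = (u, w)` of `V'` and a place `P` of `L = k(V)` there is an integer `e = e_A(P) ≥ 1` with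
`v_P(A^* t) = v_{A(P)}(t)^e` for all `t ∈ k(V')`, where `A(P) ∈ V'(k)` is the specialisation.
(At an affine specialisation: functions regular, resp. vanishing, at `A(P)` pull back to functions
regular, resp. vanishing, at `P`, then `Valuation.exists_eq_pow_of_le_one_imp`; at a pole of
`x(A)` of order `2e`: directly, through the place at infinity of `V'`.) Silverman, *AEC*, II.§2
(the ramification index `e_φ(P)`; `ord_P(φ^* f) = e_φ(P) ord_{φP}(f)`, cf. Ex. 2.2).
[folklore] -/
theorem exists_placeValuation_pointPullback_eq_pow (P : V.Point) {u w : V.FunctionField}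
    (h : (V'.baseChange V.FunctionField).toAffine.Nonsingular u w) (hu : Transcendental k u) :
    ∃ e : ℕ, 0 < e ∧ ∀ t : V'.FunctionField, placeValuation V P (pointPullback h.left hu t) =
      placeValuation V' (specialize V V' P (.some u w h)) t ^ e := by
  set v := placeValuation V P with hv
  by_cases hint : placeValuation V P u ≤ 1
  · -- affine specialisation
    rw [specialize_some_of_le_one P h hint]
    set hQ := (Affine.equation_iff_nonsingular (W := V')).mp (equation_placeRes h.left hint)
    have hreg := placeValuation_pointPullback_algebraMap_of_le_one P h.left hu hint
    refine Valuation.exists_eq_pow_of_le_one_imp (v.comap (pointPullback h.left hu).toRingHom) _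
      ?_ ?_ ((pointPrime hQ.left).valuation_exists_uniformizer V'.FunctionField)
    · intro t ht
      rw [placeValuation_some] at ht
      obtain ⟨n, d, hnd⟩ := (pointPrime hQ.left).exists_primeCompl_mul_eq_of_integer t ht
      have hd : placeRes V P (pointPullback h.left hu (algebraMap V'.CoordinateRing
        V'.FunctionField (d : V'.CoordinateRing))) ≠ 0 := by
        rw [(hreg d).2, Ne, ← mem_pointIdeal_iff]
        exact d.2
      have hd1 := placeValuation_eq_one_of_placeRes_ne_zero P (hreg d).1 hd
      have := congrArg (fun z ↦ v (pointPullback h.left hu z)) hnd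
      simp only [map_mul] at this
      rw [show v (pointPullback h.left hu (algebraMap V'.CoordinateRing V'.FunctionField
        (d : V'.CoordinateRing))) = 1 from hd1, mul_one] at this
      change v (pointPullback h.left hu t) ≤ 1
      rw [this]
      exact (hreg n).1
    · intro t ht
      rw [placeValuation_some] at ht
      obtain ⟨n, d, hnd⟩ := (pointPrime hQ.left).exists_primeCompl_mul_eq_of_integer t ht.le
      have hd : placeRes V P (pointPullback h.left hu (algebraMap V'.CoordinateRing
        V'.FunctionField (d : V'.CoordinateRing))) ≠ 0 := by
        rw [(hreg d).2, Ne, ← mem_pointIdeal_iff]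
        exact d.2
      have hd1 := placeValuation_eq_one_of_placeRes_ne_zero P (hreg d).1 hd
      -- `n` vanishes at the specialisation
      have hn : n ∈ pointIdeal V' (placeRes V P u) (placeRes V P w) := by
        have hvn : (pointPrime hQ.left).valuation V'.FunctionField
            (algebraMap _ V'.FunctionField n) < 1 := by
          rw [← hnd, map_mul]
          calc _ ≤ (pointPrime hQ.left).valuation V'.FunctionField t * 1 :=
                mul_le_mul_right (HeightOneSpectrum.valuation_le_one _ _) _
            _ < 1 := by rwa [mul_one]
        rwa [HeightOneSpectrum.valuation_lt_one_iff_mem, pointPrime_asIdeal] at hvn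
      have hn0 : placeRes V P (pointPullback h.left hu (algebraMap _ V'.FunctionField n)) = 0 := by
        rw [(hreg n).2, ← mem_pointIdeal_iff]
        exact hn
      have hn1 : v (pointPullback h.left hu (algebraMap _ V'.FunctionField n)) < 1 := by
        have := placeValuation_sub_placeRes_lt_one P (hreg n).1
        rwa [hn0, map_zero, sub_zero] at this
      have := congrArg (fun z ↦ v (pointPullback h.left hu z)) hnd
      simp only [map_mul] at this
      rw [show v (pointPullback h.left hu (algebraMap V'.CoordinateRing V'.FunctionField
        (d : V'.CoordinateRing))) = 1 from hd1, mul_one] at this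
      change v (pointPullback h.left hu t) < 1
      rw [this]
      exact hn1
  · -- pole
    push Not at hint
    rw [specialize_some_of_one_lt P h hint, placeValuation_zero]
    obtain ⟨e, he, hou, how⟩ := exists_ord_eq_of_pole h.left hint
    have hu0 : u ≠ 0 := fun h0 ↦ by rw [h0, map_zero] at hint; exact not_lt_zero hint
    have hw0 : w ≠ 0 := by
      intro h0
      have := (placeValuation_pole h.left hint).2
      rw [h0, map_zero] at this
      exact not_lt_zero this
    have heu : v u = WithZero.exp (2 * e : ℤ) := by
      rw [placeValuation_eq_exp_neg_ord P hu0, hou, neg_neg]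
    have hew : v w = WithZero.exp (3 * e : ℤ) := by
      rw [placeValuation_eq_exp_neg_ord P hw0, how, neg_neg]
    refine ⟨e, he, fun t ↦ ?_⟩
    by_cases ht : t = 0
    · rw [ht, map_zero, map_zero, map_zero, zero_pow he.ne']
    obtain ⟨a, b, hb, rfl⟩ := IsFractionRing.div_surjective (A := V'.CoordinateRing) t
    have hb' : (b : V'.CoordinateRing) ≠ 0 := nonZeroDivisors.ne_zero hb
    have ha : a ≠ 0 := by rintro rfl; simp at ht
    rw [map_div₀, map_div₀, map_div₀,
      placeValuation_pointPullback_algebraMap_of_pole P h.left hu heu hew he ha,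
      placeValuation_pointPullback_algebraMap_of_pole P h.left hu heu hew he hb',
      infValuationF_algebraMap_of_ne_zero ha, infValuationF_algebraMap_of_ne_zero hb']
    simp only [← WithZero.exp_sub, ← WithZero.exp_nsmul, nsmul_eq_mul]
    congr 1
    push_cast
    ring

/-! ## The ramification index, fibres and the fibre degree -/

variable (V V') in
/-- **The ramification index `e_A(P) ≥ 1`** of the non-constant `L`-point `A = (u, w)` at the
place `P`: `v_P ∘ A^* = v_{A(P)} ^ e_A(P)`. Silverman, *AEC*, II.§2 (`e_φ(P)`). [folklore] -/
def ramificationIdx (P : V.Point) {u w : V.FunctionField}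
    (h : (V'.baseChange V.FunctionField).toAffine.Nonsingular u w) (hu : Transcendental k u) : ℕ :=
  (exists_placeValuation_pointPullback_eq_pow P h hu).choose

/-- `e_A(P) ≥ 1`. [folklore] -/
theorem ramificationIdx_pos (P : V.Point) {u w : V.FunctionField}
    (h : (V'.baseChange V.FunctionField).toAffine.Nonsingular u w) (hu : Transcendental k u) :
    0 < ramificationIdx V V' P h hu :=
  (exists_placeValuation_pointPullback_eq_pow P h hu).choose_spec.1

/-- `v_P(A^* t) = v_{A(P)}(t) ^ e_A(P)`. Silverman, *AEC*, II.§2, Ex. 2.2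
(`ord_P(φ^* f) = e_φ(P) ord_{φP}(f)`). [folklore] -/
theorem placeValuation_pointPullback (P : V.Point) {u w : V.FunctionField}
    (h : (V'.baseChange V.FunctionField).toAffine.Nonsingular u w) (hu : Transcendental k u)
    (t : V'.FunctionField) : placeValuation V P (pointPullback h.left hu t) =
      placeValuation V' (specialize V V' P (.some u w h)) t ^ ramificationIdx V V' P h hu :=
  (exists_placeValuation_pointPullback_eq_pow P h hu).choose_spec.2 t

/-- **`ord_P(A^* t) = e_A(P) · ord_{A(P)}(t)`.** Silverman, *AEC*, II.§2, Ex. 2.2. [folklore] -/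
theorem ord_pointPullback (P : V.Point) {u w : V.FunctionField}
    (h : (V'.baseChange V.FunctionField).toAffine.Nonsingular u w) (hu : Transcendental k u)
    (t : V'.FunctionField) : ord V P (pointPullback h.left hu t) =
      ramificationIdx V V' P h hu * ord V' (specialize V V' P (.some u w h)) t := by
  by_cases ht : t = 0
  · simp [ht, ord]
  have ht' : pointPullback h.left hu t ≠ 0 :=
    (map_ne_zero_iff _ (pointPullback_injective _ hu)).mpr ht
  have := placeValuation_pointPullback P h hu t
  rw [placeValuation_eq_exp_neg_ord P ht', placeValuation_eq_exp_neg_ord _ ht,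
    ← WithZero.exp_nsmul, WithZero.exp_inj] at this
  rw [nsmul_eq_mul] at this
  linarith

omit [V.IsElliptic] in
/-- A non-constant `L`-point has transcendental, in particular non-zero and non-constant,
`x`-coordinate: `u - c ≠ 0` for every constant `c`. [folklore] -/
theorem sub_algebraMap_ne_zero_of_transcendental {u : V.FunctionField} (hu : Transcendental k u)
    (c : k) : u - algebraMap k V.FunctionField c ≠ 0 := by
  intro h0
  rw [sub_eq_zero] at h0
  exact hu (h0 ▸ isAlgebraic_algebraMap c)

/-- **The fibres of specialisation are finite**: for a non-constant `L`-point `A` and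
`Q ∈ V'(k) ∪ {O}`, only finitely many places `P` have `A(P) = Q` (they are among the poles of
`x(A)`, resp. the zeros of `x(A) - x(Q)`). Silverman, *AEC*, II.2.6(a) (`φ⁻¹(Q)` is finite).
[folklore] -/
theorem finite_fibre_specialize [IsAlgClosed k] {u w : V.FunctionField}
    (h : (V'.baseChange V.FunctionField).toAffine.Nonsingular u w) (hu : Transcendental k u)
    (Q : V'.Point) : {P : V.Point | specialize V V' P (.some u w h) = Q}.Finite := by
  cases Q with
  | zero =>
    have hu0 : u ≠ 0 := by simpa using sub_algebraMap_ne_zero_of_transcendental (V := V) hu 0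
    refine (finite_support_ord (V := V) hu0).subset fun P hP ↦ ?_
    rw [Set.mem_setOf_eq] at hP
    have hP' : 1 < placeValuation V P u := (specialize_some_eq_zero_iff P h).mp hP
    rw [placeValuation_eq_exp_neg_ord P hu0, ← WithZero.exp_zero, WithZero.exp_lt_exp] at hP'
    rw [Function.mem_support]
    omega
  | some a b hab =>
    have hu0 := sub_algebraMap_ne_zero_of_transcendental (V := V) hu a
    refine (finite_support_ord (V := V) hu0).subset fun P hP ↦ ?_
    rw [Set.mem_setOf_eq] at hP
    by_cases hint : placeValuation V P u ≤ 1
    · rw [specialize_some_of_le_one P h hint] at hP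
      obtain ⟨ha, -⟩ := Affine.Point.some.inj hP
      have hlt := placeValuation_sub_placeRes_lt_one P hint
      rw [ha, placeValuation_eq_exp_neg_ord P hu0, ← WithZero.exp_zero, WithZero.exp_lt_exp] at hlt
      rw [Function.mem_support]
      omega
    · push Not at hint
      rw [specialize_some_of_one_lt P h hint] at hP
      exact absurd hP.symm (Affine.Point.some_ne_zero _)

variable (V V') in
/-- **The degree of the fibre of `A` over `Q`**: `D_A(Q) = Σ_{P : A(P) = Q} e_A(P)`.
Silverman, *AEC*, Prop. II.2.6(a) (`Σ_{P ∈ φ⁻¹(Q)} e_φ(P) = deg φ`). [folklore] -/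
def fibreDegree [IsAlgClosed k] {u w : V.FunctionField}
    (h : (V'.baseChange V.FunctionField).toAffine.Nonsingular u w)
    (hu : Transcendental k u) (Q : V'.Point) : ℕ :=
  ∑ᶠ P : V.Point, if specialize V V' P (.some u w h) = Q then ramificationIdx V V' P h hu else 0

/-- Regrouping a finitely supported sum along a map with finite fibres. [folklore] -/
theorem finsum_mul_comp_eq_finsum_fibre {α β : Type*} (f : α → β) (g : α → ℤ) (φ : β → ℤ)
    (hφ : (Function.support φ).Finite) (hfib : ∀ b, (f ⁻¹' {b}).Finite) :
    ∑ᶠ a, g a * φ (f a) = ∑ᶠ b, φ b * ∑ᶠ a, (if f a = b then g a else 0) := by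
  classical
  set T := hφ.toFinset with hT
  have hS : (f ⁻¹' (T : Set β)).Finite := Set.Finite.preimage' (Finset.finite_toSet T)
    fun b _ ↦ hfib b
  set S := hS.toFinset with hSdef
  have hsuppL : (Function.support fun a ↦ g a * φ (f a)) ⊆ S := by
    intro a ha
    rw [Function.mem_support] at ha
    rw [hSdef, Set.Finite.coe_toFinset, Set.mem_preimage, hT, Set.Finite.coe_toFinset,
      Function.mem_support]
    exact right_ne_zero_of_mul ha
  have hsuppR : (Function.support fun b ↦ φ b * ∑ᶠ a, (if f a = b then g a else 0)) ⊆ T := by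
    intro b hb
    rw [Function.mem_support] at hb
    rw [hT, Set.Finite.coe_toFinset, Function.mem_support]
    exact left_ne_zero_of_mul hb
  rw [finsum_eq_sum_of_support_subset _ hsuppL, finsum_eq_sum_of_support_subset _ hsuppR]
  have hinner : ∀ b, ∑ᶠ a, (if f a = b then g a else 0) = ∑ a ∈ (hfib b).toFinset, g a := by
    intro b
    rw [finsum_eq_sum_of_support_subset _ (s := (hfib b).toFinset) (by
      intro a ha
      rw [Function.mem_support] at ha
      rw [Set.Finite.coe_toFinset, Set.mem_preimage, Set.mem_singleton_iff]
      by_contra hne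
      exact ha (if_neg hne))]
    refine Finset.sum_congr rfl fun a ha ↦ ?_
    rw [Set.Finite.mem_toFinset, Set.mem_preimage, Set.mem_singleton_iff] at ha
    rw [if_pos ha]
  simp_rw [hinner]
  rw [← Finset.sum_fiberwise_of_maps_to (s := S) (t := T) (g := f) (fun a ha ↦ by
    rw [hSdef, Set.Finite.mem_toFinset, Set.mem_preimage] at ha
    exact ha)]
  refine Finset.sum_congr rfl fun b hb ↦ ?_
  rw [Finset.mul_sum]
  have : (S.filter fun a ↦ f a = b) = (hfib b).toFinset := by
    ext a
    rw [Finset.mem_filter, hSdef, Set.Finite.mem_toFinset, Set.Finite.mem_toFinset,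
      Set.mem_preimage, Set.mem_preimage, Set.mem_singleton_iff]
    constructor
    · exact fun h ↦ h.2
    · intro h
      exact ⟨by rw [h]; exact hb, h⟩
  rw [this]
  refine Finset.sum_congr rfl fun a ha ↦ ?_
  rw [Set.Finite.mem_toFinset, Set.mem_preimage, Set.mem_singleton_iff] at ha
  rw [ha, mul_comm]

/-- The fibre degree as a finite sum over the fibre. [folklore] -/
theorem fibreDegree_eq_sum [IsAlgClosed k] {u w : V.FunctionField}
    (h : (V'.baseChange V.FunctionField).toAffine.Nonsingular u w) (hu : Transcendental k u)
    (Q : V'.Point) : fibreDegree V V' h hu Q =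
      ∑ P ∈ (finite_fibre_specialize h hu Q).toFinset, ramificationIdx V V' P h hu := by
  rw [fibreDegree,
    finsum_eq_sum_of_support_subset _ (s := (finite_fibre_specialize h hu Q).toFinset)
    (by
      intro P hP
      rw [Function.mem_support] at hP
      rw [Set.Finite.coe_toFinset, Set.mem_setOf_eq]
      by_contra hne
      exact hP (if_neg hne))]
  refine Finset.sum_congr rfl fun P hP ↦ ?_
  rw [Set.Finite.mem_toFinset, Set.mem_setOf_eq] at hP
  rw [if_pos hP]

/-- The fibre degree in `ℤ`, as a finitely supported sum. [folklore] -/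
theorem cast_fibreDegree [IsAlgClosed k] {u w : V.FunctionField}
    (h : (V'.baseChange V.FunctionField).toAffine.Nonsingular u w) (hu : Transcendental k u)
    (Q : V'.Point) : (fibreDegree V V' h hu Q : ℤ) =
      ∑ᶠ P : V.Point, (if specialize V V' P (.some u w h) = Q then
        (ramificationIdx V V' P h hu : ℤ) else 0) := by
  rw [fibreDegree_eq_sum, Nat.cast_sum, finsum_eq_sum_of_support_subset _
    (s := (finite_fibre_specialize h hu Q).toFinset) (by
      intro P hP
      rw [Function.mem_support] at hP
      rw [Set.Finite.coe_toFinset, Set.mem_setOf_eq]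
      by_contra hne
      exact hP (if_neg hne))]
  refine Finset.sum_congr rfl fun P hP ↦ ?_
  rw [Set.Finite.mem_toFinset, Set.mem_setOf_eq] at hP
  rw [if_pos hP]

/-- **`Σ_Q ord_Q(t) · D_A(Q) = 0` for every `t ∈ k(V') ∖ {0}`**: pull back along `A^*`, use
`ord_P(A^* t) = e_A(P) ord_{A(P)}(t)` and `deg div(A^* t) = 0` on `V`, and regroup by fibres.
Silverman, *AEC*, II.3.6(b) proof pattern (`deg φ^* D = deg φ · deg D`). [folklore] -/
theorem finsum_ord_mul_fibreDegree [IsAlgClosed k] {u w : V.FunctionField}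
    (h : (V'.baseChange V.FunctionField).toAffine.Nonsingular u w) (hu : Transcendental k u)
    {t : V'.FunctionField} (ht : t ≠ 0) :
    ∑ᶠ Q : V'.Point, ord V' Q t * fibreDegree V V' h hu Q = 0 := by
  have ht' : pointPullback h.left hu t ≠ 0 :=
    (map_ne_zero_iff _ (pointPullback_injective _ hu)).mpr ht
  have h0 := finsum_ord (V := V) ht'
  simp_rw [ord_pointPullback _ h hu t] at h0
  have key := finsum_mul_comp_eq_finsum_fibre (fun P ↦ specialize V V' P (.some u w h))
    (fun P ↦ (ramificationIdx V V' P h hu : ℤ)) (fun Q ↦ ord V' Q t) (finite_support_ord ht)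
    (fun Q ↦ finite_fibre_specialize h hu Q)
  rw [key] at h0
  rw [← h0]
  refine finsum_congr fun Q ↦ ?_
  rw [cast_fibreDegree]
  congr 1
  refine finsum_congr fun P ↦ ?_
  by_cases hP : specialize V V' P (.some u w h) = Q <;> simp [hP]

/-! ## Two principal divisors on `V'`: `x - a` and a chord -/

omit [V.IsElliptic] in
/-- `ord_Q(n) ≥ 0` at affine `Q` for `n ∈ k[V']`. [folklore] -/
theorem ord_some_algebraMap_nonneg {a b : k} (h : V'.Nonsingular a b) (n : V'.CoordinateRing) :
    0 ≤ ord V' (.some a b h) (algebraMap V'.CoordinateRing V'.FunctionField n) := by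
  by_cases hn : n = 0
  · simp [hn, ord]
  have := placeValuation_some_algebraMap_le_one h n
  rw [placeValuation_eq_exp_neg_ord _ (by simpa using hn), ← WithZero.exp_zero,
    WithZero.exp_le_exp] at this
  omega

omit [V.IsElliptic] in
/-- `ord_Q(n) > 0 ↔ n(Q) = 0` at affine `Q` for `n ∈ k[V'] ∖ {0}`. [folklore] -/
theorem ord_some_algebraMap_pos_iff {a b : k} (h : V'.Nonsingular a b) {n : V'.CoordinateRing}
    (hn : n ≠ 0) :
    0 < ord V' (.some a b h) (algebraMap V'.CoordinateRing V'.FunctionField n) ↔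
      pointEval h.left n = 0 := by
  rw [← placeValuation_some_algebraMap_lt_one_iff h, placeValuation_eq_exp_neg_ord _
    (by simpa using hn), ← WithZero.exp_zero, WithZero.exp_lt_exp]
  omega

/-- **Counting zeros**: if `F = ord(t)` has `F(O) = -m`, `Σ F = 0`, and every other point with
`F ≠ 0` lies in the finite set `Z ∌ O`, then `Σ_{Q ∈ Z} F(Q) = m` and
`Σ_Q F(Q) D(Q) = -m D(O) + Σ_{Q ∈ Z} F(Q) D(Q)` for every `D`. [folklore] -/
theorem finsum_mul_eq_of_zeros {β : Type*} [Zero β] (F : β → ℤ) (m : ℕ)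
    (_hfin : (Function.support F).Finite) (hsum : ∑ᶠ Q, F Q = 0) (h0 : F 0 = -m)
    (Z : Finset β) (hZ0 : (0 : β) ∉ Z) (hzeros : ∀ Q, Q ≠ 0 → F Q ≠ 0 → Q ∈ Z) :
    ∑ Q ∈ Z, F Q = m ∧ ∀ D : β → ℤ, ∑ᶠ Q, F Q * D Q = -m * D 0 + ∑ Q ∈ Z, F Q * D Q := by
  classical
  have hsupp : ∀ G : β → ℤ, Function.support G ⊆ Function.support F →
      Function.support G ⊆ ((insert 0 Z : Finset β) : Set β) := by
    intro G hG Q hQ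
    have hQ' := hG hQ
    rw [Finset.coe_insert]
    by_cases hQ0 : Q = 0
    · exact hQ0 ▸ Set.mem_insert _ _
    · exact Set.mem_insert_of_mem _ (hzeros Q hQ0 (Function.mem_support.mp hQ'))
  have hdecomp : ∀ G : β → ℤ, Function.support G ⊆ Function.support F →
      ∑ᶠ Q, G Q = G 0 + ∑ Q ∈ Z, G Q := by
    intro G hG
    rw [finsum_eq_sum_of_support_subset _ (hsupp G hG), Finset.sum_insert hZ0]
  have hF := hdecomp F subset_rfl
  rw [hsum, h0] at hF
  refine ⟨by linarith, fun D ↦ ?_⟩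
  rw [hdecomp (fun Q ↦ F Q * D Q) (fun Q hQ ↦ by
    rw [Function.mem_support] at hQ ⊢
    exact left_ne_zero_of_mul hQ), h0, neg_mul]

variable (V') in
/-- The regular function `x' - a ∈ k[V']`. [folklore] -/
abbrev xSubC (a : k) : V'.CoordinateRing := algebraMap k[X] V'.CoordinateRing (X - C a)

omit [V.IsElliptic] [V'.IsElliptic] in
/-- `x' - a ≠ 0`. [folklore] -/
theorem xSubC_ne_zero (a : k) : xSubC V' a ≠ 0 := fun h ↦
  X_sub_C_ne_zero a (Literature.NumberTheory.EllipticCurves.WeierstrassCoordinateRing.algebraMap_injective V'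
    (h.trans (map_zero _).symm))

omit [V.IsElliptic] [V'.IsElliptic] in
/-- `(x' - a)(a', b') = a' - a`. [folklore] -/
theorem pointEval_xSubC {a' b' : k} (h : V'.Equation a' b') (a : k) :
    pointEval h (xSubC V' a) = a' - a := by
  rw [xSubC, show algebraMap k[X] V'.CoordinateRing (X - C a) =
    Affine.CoordinateRing.mk V' (C (X - C a)) from rfl, pointEval_mk, evalEval_C, eval_sub,
    eval_X, eval_C]

omit [V.IsElliptic] in
/-- `ord_O(x' - a) = -2`. [folklore] -/
theorem ord_zero_xSubC (a : k) :
    ord V' 0 (algebraMap V'.CoordinateRing V'.FunctionField (xSubC V' a)) = -2 := by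
  rw [ord_zero_algebraMap (xSubC_ne_zero a)]
  have : xSubC V' a = (X - C a) • (1 : V'.CoordinateRing) +
      (0 : k[X]) • Affine.CoordinateRing.mk V' Y := by
    rw [zero_smul, add_zero, Algebra.smul_def, mul_one]
  rw [this, normDeg_smul_basis_eq _ _ (Or.inl (X_sub_C_ne_zero a)), if_pos rfl, natDegree_X_sub_C]
  norm_num

omit [V.IsElliptic] in
/-- **The divisor of `x' - a`**: for an affine point `Q₀ = (a, b₀)` of `V'`,
`Σ_Q ord_Q(x' - a) D(Q) = -2 D(O) + D(Q₀) + D(-Q₀)` (`div (x' - a) = (Q₀) + (-Q₀) - 2 (O)`, the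
two points coinciding when `Q₀` is `2`-torsion). Silverman, *AEC*, II.3.5, III.§3
(`div (x - e₁) = 2(P₁) - 2(O)`). [folklore] -/
theorem finsum_ord_xSubC_mul [IsAlgClosed k] (D : V'.Point → ℤ) {a b₀ : k}
    (h₀ : V'.Nonsingular a b₀) :
    ∑ᶠ Q, ord V' Q (algebraMap V'.CoordinateRing V'.FunctionField (xSubC V' a)) * D Q =
      -2 * D 0 + D (.some a b₀ h₀) + D (-.some a b₀ h₀) := by
  classical
  set t := algebraMap V'.CoordinateRing V'.FunctionField (xSubC V' a) with ht
  have ht0 : t ≠ 0 :=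
    (map_ne_zero_iff _ (FaithfulSMul.algebraMap_injective _ _)).mpr (xSubC_ne_zero a)
  set F : V'.Point → ℤ := fun Q ↦ ord V' Q t with hF
  have hzx : ∀ {a' b' : k} (h' : V'.Nonsingular a' b'), F (.some a' b' h') ≠ 0 → a' = a := by
    intro a' b' h' hne
    have hpos : 0 < F (.some a' b' h') :=
      lt_of_le_of_ne (ord_some_algebraMap_nonneg h' _) (Ne.symm hne)
    rw [hF] at hpos
    simp only at hpos
    rw [ht, ord_some_algebraMap_pos_iff h' (xSubC_ne_zero a), pointEval_xSubC] at hpos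
    exact sub_eq_zero.mp hpos
  have hposQ₀ : ∀ {b' : k} (h' : V'.Nonsingular a b'), 1 ≤ F (.some a b' h') := by
    intro b' h'
    have : 0 < F (.some a b' h') := by
      rw [hF]; simp only
      rw [ht, ord_some_algebraMap_pos_iff h' (xSubC_ne_zero a), pointEval_xSubC, sub_self]
    omega
  -- the points with `x = a` are `Q₀` and `-Q₀`
  have hother : ∀ {b' : k} (h' : V'.Nonsingular a b'),
      Affine.Point.some a b' h' = .some a b₀ h₀ ∨ Affine.Point.some a b' h' = -.some a b₀ h₀ := by
    intro b' h'
    rcases Affine.Y_eq_of_X_eq h'.left h₀.left rfl with hb | hb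
    · left; subst hb; rfl
    · right; rw [Affine.Point.neg_some]; subst hb; rfl
  set Z : Finset V'.Point := insert (.some a b₀ h₀) {-.some a b₀ h₀} with hZ
  have hZ0 : (0 : V'.Point) ∉ Z := by
    rw [hZ, Finset.mem_insert, Finset.mem_singleton, Affine.Point.neg_some]
    push Not
    exact ⟨(Affine.Point.some_ne_zero _).symm, (Affine.Point.some_ne_zero _).symm⟩
  have hzeros : ∀ Q : V'.Point, Q ≠ 0 → F Q ≠ 0 → Q ∈ Z := by
    rintro (_ | ⟨a', b', h'⟩) hQ hFQ
    · exact (hQ rfl).elim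
    · obtain rfl := hzx h' hFQ
      rw [hZ, Finset.mem_insert, Finset.mem_singleton]
      exact hother h'
  obtain ⟨hcount, hD⟩ := finsum_mul_eq_of_zeros F 2 (finite_support_ord ht0) (finsum_ord ht0)
    (ord_zero_xSubC a) Z hZ0 hzeros
  push_cast at hcount hD
  rw [hD D]
  by_cases hneg : Affine.Point.some a b₀ h₀ = -.some a b₀ h₀
  · have hZ' : Z = {Affine.Point.some a b₀ h₀} := by
      rw [hZ, ← hneg, Finset.insert_eq_of_mem (Finset.mem_singleton_self _)]
    rw [hZ', Finset.sum_singleton] at hcount ⊢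
    rw [hcount, ← hneg]
    ring
  · rw [hZ, Finset.sum_insert (by rwa [Finset.mem_singleton]), Finset.sum_singleton] at hcount ⊢
    have h1 := hposQ₀ h₀
    have h2 : 1 ≤ F (-.some a b₀ h₀) := by
      rw [Affine.Point.neg_some]; exact hposQ₀ _
    have e1 : F (.some a b₀ h₀) = 1 := by linarith
    have e2 : F (-.some a b₀ h₀) = 1 := by linarith
    rw [e1, e2]
    ring

/-- `(p.eval q).eval x = p.evalEval x (q.eval x)` for `p ∈ R[X][Y]`, `q ∈ R[X]`. [folklore] -/
theorem eval_eval_eq_evalEval {R : Type*} [CommRing R] (p : R[X][Y]) (q : R[X]) (x : R) :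
    (p.eval q).eval x = p.evalEval x (q.eval x) := by
  have : (evalRingHom x).comp (evalRingHom q) = evalEvalRingHom x (q.eval x) := by
    refine Polynomial.ringHom_ext' (RingHom.ext fun r ↦ ?_) ?_
    · simp
    · simp
  exact RingHom.congr_fun this p

omit [V.IsElliptic] [V'.IsElliptic] in
/-- A line has degree `≤ 1`. [folklore] -/
theorem natDegree_linePolynomial_le (x y ℓ : k) : (Affine.linePolynomial x y ℓ).natDegree ≤ 1 := by
  rw [Affine.linePolynomial]
  refine (natDegree_add_le _ _).trans (max_le ?_ (by simp))
  exact (natDegree_C_mul_le _ _).trans (natDegree_X_sub_C_le _)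

variable (V') in
/-- The regular function `y' - (ℓ (x' - x₁) + y₁) ∈ k[V']` cutting out the line of slope `ℓ`
through `(x₁, y₁)`. [folklore] -/
abbrev lineFn (x₁ y₁ ℓ : k) : V'.CoordinateRing :=
  Affine.CoordinateRing.mk V' (Y - C (Affine.linePolynomial x₁ y₁ ℓ))

omit [V.IsElliptic] [V'.IsElliptic] in
/-- The line function in the basis `1, y`. [folklore] -/
theorem lineFn_eq_smul_basis (x₁ y₁ ℓ : k) : lineFn V' x₁ y₁ ℓ =
    (-Affine.linePolynomial x₁ y₁ ℓ) • (1 : V'.CoordinateRing) +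
      (1 : k[X]) • Affine.CoordinateRing.mk V' Y := by
  rw [lineFn, one_smul, Algebra.smul_def, mul_one, map_sub, map_neg, sub_eq_neg_add]
  rfl

omit [V.IsElliptic] [V'.IsElliptic] in
/-- The line function is non-zero. [folklore] -/
theorem lineFn_ne_zero (x₁ y₁ ℓ : k) : lineFn V' x₁ y₁ ℓ ≠ 0 := by
  rw [lineFn_eq_smul_basis]
  intro h0
  exact one_ne_zero (Affine.CoordinateRing.smul_basis_eq_zero h0).2

omit [V.IsElliptic] [V'.IsElliptic] in
/-- The value of the line function at `(x₀, y₀)` is `y₀ - (ℓ (x₀ - x₁) + y₁)`. [folklore] -/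
theorem pointEval_lineFn {x₀ y₀ : k} (h : V'.Equation x₀ y₀) (x₁ y₁ ℓ : k) :
    pointEval h (lineFn V' x₁ y₁ ℓ) = y₀ - (ℓ * (x₀ - x₁) + y₁) := by
  rw [lineFn, pointEval_mk, evalEval_sub, evalEval_X, evalEval_C, Affine.linePolynomial]
  simp

omit [V.IsElliptic] in
/-- `ord_O` of the line function is `-3`. [folklore] -/
theorem ord_zero_lineFn (x₁ y₁ ℓ : k) :
    ord V' 0 (algebraMap V'.CoordinateRing V'.FunctionField (lineFn V' x₁ y₁ ℓ)) = -3 := by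
  rw [ord_zero_algebraMap (lineFn_ne_zero x₁ y₁ ℓ), lineFn_eq_smul_basis,
    normDeg_smul_basis_eq _ _ (Or.inr one_ne_zero), if_neg one_ne_zero]
  have hdeg : (-Affine.linePolynomial x₁ y₁ ℓ).natDegree ≤ 1 := by
    rw [natDegree_neg]; exact natDegree_linePolynomial_le x₁ y₁ ℓ
  split_ifs with hp
  · simp
  · rw [natDegree_one]
    have : max (2 * (-Affine.linePolynomial x₁ y₁ ℓ).natDegree) (2 * 0 + 3) = 3 :=
      max_eq_right (by omega)
    rw [this]; norm_num

omit [V.IsElliptic] in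
/-- **The divisor of a chord**: for affine points `Q₁ = (x₁, y₁)`, `Q₂ = (x₂, y₂)` of `V'` with
`x₁ ≠ x₂`, chord of slope `ℓ` and third intersection point `Q₃ = (x₃, ℓ(x₃ - x₁) + y₁)`
(`x₃ = addX`; so `Q₃ = -(Q₁ + Q₂)`), if `Q₃ ∉ {Q₁, Q₂}` then
`Σ_Q ord_Q(y' - ℓ(x' - x₁) - y₁) D(Q) = -3 D(O) + D(Q₁) + D(Q₂) + D(Q₃)`
(`div = (Q₁) + (Q₂) + (Q₃) - 3 (O)`). Silverman, *AEC*, III.§3 (proof of Prop. III.3.4: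
`div (f/Z) = (P) + (Q) + (R) - 3 (O)` for the line `f` through `P, Q`). [folklore] -/
theorem finsum_ord_lineFn_mul [IsAlgClosed k] (D : V'.Point → ℤ) {x₁ y₁ x₂ y₂ : k}
    (h₁ : V'.Nonsingular x₁ y₁)
    (h₂ : V'.Nonsingular x₂ y₂) (hx : x₁ ≠ x₂)
    (h₃₁ : Affine.Point.some _ _ (Affine.nonsingular_negAdd h₁ h₂ fun h ↦ hx h.1) ≠ .some x₁ y₁ h₁)
    (h₃₂ : Affine.Point.some _ _ (Affine.nonsingular_negAdd h₁ h₂ fun h ↦ hx h.1) ≠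
      .some x₂ y₂ h₂) :
    ∑ᶠ Q, ord V' Q (algebraMap V'.CoordinateRing V'.FunctionField
      (lineFn V' x₁ y₁ (V'.slope x₁ x₂ y₁ y₂))) * D Q =
      -3 * D 0 + D (.some x₁ y₁ h₁) + D (.some x₂ y₂ h₂) +
        D (.some _ _ (Affine.nonsingular_negAdd h₁ h₂ fun h ↦ hx h.1)) := by
  classical
  set ℓ := V'.slope x₁ x₂ y₁ y₂ with hℓ
  set x₃ := V'.addX x₁ x₂ ℓ with hx₃
  set h₃ := Affine.nonsingular_negAdd h₁ h₂ fun h ↦ hx h.1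
  set t := algebraMap V'.CoordinateRing V'.FunctionField (lineFn V' x₁ y₁ ℓ) with ht
  have ht0 : t ≠ 0 :=
    (map_ne_zero_iff _ (FaithfulSMul.algebraMap_injective _ _)).mpr (lineFn_ne_zero x₁ y₁ ℓ)
  set F : V'.Point → ℤ := fun Q ↦ ord V' Q t with hF
  have hℓ' : ℓ * (x₂ - x₁) + y₁ = y₂ := by
    rw [hℓ, Affine.slope_of_X_ne hx]
    field_simp [sub_ne_zero.mpr hx, sub_ne_zero.mpr (Ne.symm hx)]
    ring
  -- zeros of `t` are `Q₁, Q₂, Q₃`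
  have hzeros' : ∀ {x₀ y₀ : k} (h₀ : V'.Nonsingular x₀ y₀), F (.some x₀ y₀ h₀) ≠ 0 →
      Affine.Point.some x₀ y₀ h₀ = .some x₁ y₁ h₁ ∨ Affine.Point.some x₀ y₀ h₀ = .some x₂ y₂ h₂ ∨
        Affine.Point.some x₀ y₀ h₀ = .some _ _ h₃ := by
    intro x₀ y₀ h₀ hne
    have hpos : 0 < F (.some x₀ y₀ h₀) :=
      lt_of_le_of_ne (ord_some_algebraMap_nonneg h₀ _) (Ne.symm hne)
    rw [hF] at hpos
    simp only at hpos
    rw [ht, ord_some_algebraMap_pos_iff h₀ (lineFn_ne_zero x₁ y₁ ℓ), pointEval_lineFn,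
      sub_eq_zero] at hpos
    -- `x₀` is a root of the cubic `addPolynomial`
    have hline : (Affine.linePolynomial x₁ y₁ ℓ).eval x₀ = y₀ := by
      simp [Affine.linePolynomial, hpos]
    have hcubic : (V'.addPolynomial x₁ y₁ ℓ).eval x₀ = 0 := by
      rw [Affine.addPolynomial, eval_eval_eq_evalEval, hline]
      exact h₀.left
    rw [hℓ, Affine.addPolynomial_slope h₁.left h₂.left (fun h ↦ hx h.1), eval_neg, neg_eq_zero,
      eval_mul, eval_mul, mul_eq_zero, mul_eq_zero, eval_sub, eval_sub, eval_sub, eval_X, eval_C,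
      eval_C, eval_C, sub_eq_zero, sub_eq_zero, sub_eq_zero] at hcubic
    rcases hcubic with (rfl | rfl) | rfl
    · left
      have : y₀ = y₁ := by rw [hpos]; ring
      subst this; rfl
    · right; left
      have : y₀ = y₂ := by rw [hpos, hℓ']
      subst this; rfl
    · right; right
      have : y₀ = V'.negAddY x₁ x₂ y₁ (V'.slope x₁ x₂ y₁ y₂) := by
        rw [hpos, Affine.negAddY]
      subst this; rfl
  have hval : ∀ {x₀ y₀ : k} (h₀ : V'.Nonsingular x₀ y₀), y₀ = ℓ * (x₀ - x₁) + y₁ →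
      1 ≤ F (.some x₀ y₀ h₀) := by
    intro x₀ y₀ h₀ hy
    have : 0 < F (.some x₀ y₀ h₀) := by
      rw [hF]; simp only
      rw [ht, ord_some_algebraMap_pos_iff h₀ (lineFn_ne_zero x₁ y₁ ℓ), pointEval_lineFn, hy,
        sub_self]
    omega
  set Z : Finset V'.Point := insert (.some x₁ y₁ h₁) (insert (.some x₂ y₂ h₂) {.some _ _ h₃})
    with hZ
  have hZ0 : (0 : V'.Point) ∉ Z := by
    rw [hZ]
    simp only [Finset.mem_insert, Finset.mem_singleton, not_or]
    exact ⟨(Affine.Point.some_ne_zero _).symm, (Affine.Point.some_ne_zero _).symm,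
      (Affine.Point.some_ne_zero _).symm⟩
  have hzeros : ∀ Q : V'.Point, Q ≠ 0 → F Q ≠ 0 → Q ∈ Z := by
    rintro (_ | ⟨x₀, y₀, h₀⟩) hQ hFQ
    · exact (hQ rfl).elim
    · rw [hZ]
      simp only [Finset.mem_insert, Finset.mem_singleton]
      exact hzeros' h₀ hFQ
  obtain ⟨hcount, hD⟩ := finsum_mul_eq_of_zeros F 3 (finite_support_ord ht0) (finsum_ord ht0)
    (ord_zero_lineFn x₁ y₁ ℓ) Z hZ0 hzeros
  push_cast at hcount hD
  rw [hD D]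
  have h12 : Affine.Point.some x₁ y₁ h₁ ≠ .some x₂ y₂ h₂ := fun h ↦ hx (Affine.Point.some.inj h).1
  have hmem1 : Affine.Point.some x₁ y₁ h₁ ∉ insert (Affine.Point.some x₂ y₂ h₂)
      ({.some _ _ h₃} : Finset V'.Point) := by
    simp only [Finset.mem_insert, Finset.mem_singleton, not_or]
    exact ⟨h12, h₃₁.symm⟩
  have hmem2 : Affine.Point.some x₂ y₂ h₂ ∉ ({.some _ _ h₃} : Finset V'.Point) := by
    simp only [Finset.mem_singleton]
    exact h₃₂.symm
  rw [hZ, Finset.sum_insert hmem1, Finset.sum_insert hmem2, Finset.sum_singleton] at hcount ⊢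
  have e1 := hval h₁ (by ring)
  have e2 := hval h₂ hℓ'.symm
  have e3 := hval h₃ (by rw [Affine.negAddY])
  have f1 : F (.some x₁ y₁ h₁) = 1 := by linarith
  have f2 : F (.some x₂ y₂ h₂) = 1 := by linarith
  have f3 : F (.some _ _ h₃) = 1 := by linarith
  rw [f1, f2, f3]
  ring

/-! ## Constancy of the fibre degree -/

omit [V.IsElliptic] [V'.IsElliptic] in
/-- `-(Q₁ + Q₂)` is the third intersection point `(x₃, ℓ(x₃ - x₁) + y₁)` of the chord.
[folklore] -/
theorem neg_add_eq_some_negAdd {x₁ y₁ x₂ y₂ : k} (h₁ : V'.Nonsingular x₁ y₁)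
    (h₂ : V'.Nonsingular x₂ y₂) (hx : x₁ ≠ x₂) :
    -(Affine.Point.some x₁ y₁ h₁ + Affine.Point.some x₂ y₂ h₂) =
      .some _ _ (Affine.nonsingular_negAdd h₁ h₂ fun h ↦ hx h.1) := by
  rw [Affine.Point.add_of_X_ne hx, Affine.Point.neg_some]
  simp only [Affine.Point.some.injEq, true_and]
  rw [Affine.addY, Affine.negY_negY]

omit [V.IsElliptic] [V'.IsElliptic] in
/-- An affine point of `V'` has coordinates. [folklore] -/
theorem Point.exists_eq_some {Q : V'.Point} (hQ : Q ≠ 0) :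
    ∃ x y h, Q = Affine.Point.some x y h := by
  cases Q with
  | zero => exact (hQ rfl).elim
  | some x y h => exact ⟨x, y, h, rfl⟩

/-- The fibres of doubling on `V'(k)` are finite (`V'[2]` is finite, tree's
`WeierstrassCurve.finite_torsionBy_of_isAlgClosed`). [folklore] -/
theorem finite_setOf_two_nsmul_eq [IsAlgClosed k] (T : V'.Point) :
    {S : V'.Point | 2 • S = T}.Finite := by
  by_cases hne : {S : V'.Point | 2 • S = T}.Nonempty
  · obtain ⟨S₀, hS₀⟩ := hne
    haveI := WeierstrassCurve.finite_torsionBy_of_isAlgClosed (V := V') (n := 2) two_ne_zero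
    have hfin : (↑(V'.toAffine.Point[(2 : ℤ)]) : Set V'.Point).Finite := Set.toFinite _
    refine (hfin.image fun R ↦ R + S₀).subset fun S hS ↦ ?_
    refine ⟨S - S₀, ?_, sub_add_cancel S S₀⟩
    rw [Set.mem_setOf_eq] at hS hS₀
    rw [SetLike.mem_coe, AddSubgroup.torsionBy, Submodule.mem_toAddSubgroup,
      Submodule.mem_torsionBy_iff, smul_sub,
      show ((2 : ℤ) • S : V'.Point) = 2 • S from natCast_zsmul S 2,
      show ((2 : ℤ) • S₀ : V'.Point) = 2 • S₀ from natCast_zsmul S₀ 2, hS, hS₀, sub_self]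
  · rw [Set.not_nonempty_iff_eq_empty.mp hne]
    exact Set.finite_empty

/-- **A function on `V'(k) ∪ {O}` satisfying the relations of the principal divisors of `x' - a`
and of chords, and bounded below, is constant.** With `h = D - D(O)`: the first relation gives
`h(-Q) = -h(Q)`, the second `h(Q₁ + Q₂) = h(Q₁) + h(Q₂)` for generic pairs, whence (inserting a
generic auxiliary point, `V'(k)` being infinite) for all pairs; an additive function bounded
below on the divisible... on any group is zero. [folklore] -/
theorem eq_apply_zero_of_divisor_relations [IsAlgClosed k] (D : V'.Point → ℤ)
    (hx : ∀ (a b : k) (h : V'.Nonsingular a b),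
      -2 * D 0 + D (.some a b h) + D (-.some a b h) = 0)
    (hc : ∀ (x₁ y₁ x₂ y₂ : k) (h₁ : V'.Nonsingular x₁ y₁) (h₂ : V'.Nonsingular x₂ y₂)
      (hx : x₁ ≠ x₂),
      Affine.Point.some _ _ (Affine.nonsingular_negAdd h₁ h₂ fun h ↦ hx h.1) ≠ .some x₁ y₁ h₁ →
      Affine.Point.some _ _ (Affine.nonsingular_negAdd h₁ h₂ fun h ↦ hx h.1) ≠ .some x₂ y₂ h₂ →
      -3 * D 0 + D (.some x₁ y₁ h₁) + D (.some x₂ y₂ h₂) +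
        D (.some _ _ (Affine.nonsingular_negAdd h₁ h₂ fun h ↦ hx h.1)) = 0)
    (hbd : ∃ c : ℤ, ∀ Q, c ≤ D Q) (Q : V'.Point) : D Q = D 0 := by
  set hD : V'.Point → ℤ := fun Q ↦ D Q - D 0 with hhD
  -- `h(-Q) = -h(Q)`
  have hneg : ∀ Q, hD (-Q) = -hD Q := by
    rintro (_ | ⟨a, b, h⟩)
    · change hD (-0) = -hD 0
      rw [neg_zero, hhD]; simp
    · have := hx a b h
      rw [hhD]; simp only; linarith
  have hD0 : hD 0 = 0 := by rw [hhD]; simp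
  -- additivity for generic pairs
  have hgen : ∀ A B : V'.Point, A ≠ 0 → B ≠ 0 → A ≠ B → A ≠ -B → B ≠ -(2 • A) → A ≠ -(2 • B) →
      hD (A + B) = hD A + hD B := by
    intro A B hA hB h1 h2 h3 h4
    obtain ⟨x₁, y₁, h₁, rfl⟩ := Point.exists_eq_some hA
    obtain ⟨x₂, y₂, h₂, rfl⟩ := Point.exists_eq_some hB
    have hx12 : x₁ ≠ x₂ := fun h ↦ by
      rcases (Affine.Point.X_eq_iff (h₁ := h₁) (h₂ := h₂)).mp h with h' | h'
      · exact h1 h'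
      · exact h2 h'
    have hQ₃ := neg_add_eq_some_negAdd h₁ h₂ hx12
    have h31 : Affine.Point.some _ _ (Affine.nonsingular_negAdd h₁ h₂ fun h ↦ hx12 h.1) ≠
        .some x₁ y₁ h₁ := by
      rw [← hQ₃]; intro h'
      apply h3
      calc Affine.Point.some x₂ y₂ h₂
          = -(-(Affine.Point.some x₁ y₁ h₁ + .some x₂ y₂ h₂)) - .some x₁ y₁ h₁ := by abel
        _ = -(Affine.Point.some x₁ y₁ h₁) - .some x₁ y₁ h₁ := by rw [h']
        _ = -(2 • Affine.Point.some x₁ y₁ h₁) := by abel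
    have h32 : Affine.Point.some _ _ (Affine.nonsingular_negAdd h₁ h₂ fun h ↦ hx12 h.1) ≠
        .some x₂ y₂ h₂ := by
      rw [← hQ₃]; intro h'
      apply h4
      calc Affine.Point.some x₁ y₁ h₁
          = -(-(Affine.Point.some x₁ y₁ h₁ + .some x₂ y₂ h₂)) - .some x₂ y₂ h₂ := by abel
        _ = -(Affine.Point.some x₂ y₂ h₂) - .some x₂ y₂ h₂ := by rw [h']
        _ = -(2 • Affine.Point.some x₂ y₂ h₂) := by abel
    have := hc x₁ y₁ x₂ y₂ h₁ h₂ hx12 h31 h32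
    rw [← hQ₃, ] at this
    have e3 := hneg (Affine.Point.some x₁ y₁ h₁ + .some x₂ y₂ h₂)
    rw [hhD] at e3 ⊢
    simp only at e3 ⊢
    linarith
  -- additivity for all pairs
  have hadd : ∀ R₁ R₂ : V'.Point, hD (R₁ + R₂) = hD R₁ + hD R₂ := by
    intro R₁ R₂
    by_cases hR₁ : R₁ = 0
    · rw [hR₁, zero_add, hD0, zero_add]
    by_cases hR₂ : R₂ = 0
    · rw [hR₂, add_zero, hD0, add_zero]
    by_cases hopp : R₁ = -R₂
    · rw [hopp, neg_add_cancel, hD0, hneg, neg_add_cancel]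
    -- a generic auxiliary point
    set bad : Set V'.Point :=
      {0, -R₁, R₂, -(2 • R₁) - R₂, R₁ + 2 • R₂, R₁, -(2 • R₁), -R₂, 2 • R₂} ∪
      ({S | 2 • S = R₂ - R₁} ∪ {S | 2 • S = -R₁} ∪ {S | 2 • S = R₂}) with hbad
    have hbadfin : bad.Finite := by
      refine Set.Finite.union (by
        refine Set.Finite.insert _ (Set.Finite.insert _ (Set.Finite.insert _ (Set.Finite.insert _
          (Set.Finite.insert _ (Set.Finite.insert _ (Set.Finite.insert _ (Set.Finite.insert _
          (Set.finite_singleton _))))))))) ?_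
      exact ((finite_setOf_two_nsmul_eq _).union (finite_setOf_two_nsmul_eq _)).union
        (finite_setOf_two_nsmul_eq _)
    haveI : Infinite V'.Point := WeierstrassCurve.infinite_point (V := V')
    obtain ⟨S, hS⟩ := hbadfin.infinite_compl.nonempty
    rw [hbad] at hS
    simp only [Set.mem_compl_iff, Set.mem_union, Set.mem_insert_iff, Set.mem_singleton_iff,
      Set.mem_setOf_eq, not_or] at hS
    obtain ⟨⟨hS0, hS1, hS2, hS3, hS4, hS5, hS6, hS7, hS8⟩, ⟨hT1, hT2⟩, hT3⟩ := hS
    have e1 : hD (R₁ + R₂) = hD (R₁ + S) + hD (R₂ - S) := by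
      rw [show R₁ + R₂ = (R₁ + S) + (R₂ - S) by abel]
      refine hgen _ _ ?_ ?_ ?_ ?_ ?_ ?_
      · intro h; exact hS1 (eq_neg_of_add_eq_zero_right h)
      · intro h; exact hS2 (sub_eq_zero.mp h).symm
      · intro h; apply hT1
        calc 2 • S = (R₁ + S) + S - R₁ := by abel
          _ = (R₂ - S) + S - R₁ := by rw [h]
          _ = R₂ - R₁ := by abel
      · intro h; apply hopp
        calc R₁ = (R₁ + S) - S := by abel
          _ = -(R₂ - S) - S := by rw [h]
          _ = -R₂ := by abel
      · intro h; apply hS3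
        calc S = (2 • (R₁ + S) + (R₂ - S)) - 2 • R₁ - R₂ := by abel
          _ = (2 • (R₁ + S) + -(2 • (R₁ + S))) - 2 • R₁ - R₂ := by rw [h]
          _ = -(2 • R₁) - R₂ := by abel
      · intro h; apply hS4
        calc S = -((R₁ + S) + 2 • (R₂ - S)) + R₁ + 2 • R₂ := by abel
          _ = -(-(2 • (R₂ - S)) + 2 • (R₂ - S)) + R₁ + 2 • R₂ := by rw [h]
          _ = R₁ + 2 • R₂ := by abel
    have e2 : hD (R₁ + S) = hD R₁ + hD S := by
      refine hgen _ _ hR₁ hS0 (Ne.symm hS5) ?_ hS6 ?_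
      · intro h; apply hS1; rw [h, neg_neg]
      · intro h; apply hT2; rw [h, neg_neg]
    have e3 : hD (R₂ - S) = hD R₂ + hD (-S) := by
      rw [sub_eq_add_neg]
      refine hgen _ _ hR₂ (neg_ne_zero.mpr hS0) ?_ ?_ ?_ ?_
      · intro h; apply hS7; rw [h, neg_neg]
      · intro h; rw [neg_neg] at h; exact hS2 h.symm
      · intro h; exact hS8 (neg_inj.mp h)
      · intro h; apply hT3
        calc 2 • S = -(2 • -S) := by abel
          _ = R₂ := by rw [← h]
    rw [e1, e2, e3, hneg]
    abel
  -- an additive function bounded below is zero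
  obtain ⟨c, hcb⟩ := hbd
  have hbound : ∀ R, c - D 0 ≤ hD R := fun R ↦ by rw [hhD]; simp only; linarith [hcb R]
  let f : V'.Point →+ ℤ := { toFun := hD, map_zero' := hD0, map_add' := hadd }
  have hnsmul : ∀ (n : ℕ) (R : V'.Point), hD (n • R) = n * hD R := fun n R ↦ by
    change f (n • R) = n * f R
    rw [map_nsmul, nsmul_eq_mul]
  have hzero : ∀ R, hD R = 0 := by
    intro R
    by_contra hne
    -- pick the sign with `hD < 0`
    obtain ⟨R', hR'⟩ : ∃ R', hD R' < 0 := by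
      rcases lt_or_gt_of_ne hne with hlt | hgt
      · exact ⟨R, hlt⟩
      · exact ⟨-R, by rw [hneg]; linarith⟩
    set n : ℕ := (D 0 - c).toNat + 1 with hn
    have h1 := hbound (n • R')
    rw [hnsmul] at h1
    have hn1 : (1 : ℤ) ≤ n := by simp [hn]
    have hn2 : (D 0 - c : ℤ) < n := by
      have : (D 0 - c : ℤ) ≤ (D 0 - c).toNat := Int.self_le_toNat _
      push_cast [hn]
      linarith
    nlinarith
  have := hzero Q
  rw [hhD] at this
  simp only at this
  linarith

/-- **Constancy of the fibre degree**: `D_A(Q) = D_A(O)` for every `Q` — the number of points in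
a fibre of the non-constant `L`-point `A`, counted with ramification, does not depend on the
fibre. (From `Σ_Q ord_Q(t) D_A(Q) = 0` for `t = x' - a` and for chords, through
`eq_apply_zero_of_divisor_relations`.) Silverman, *AEC*, Prop. II.2.6(a)
(`Σ_{P ∈ φ⁻¹(Q)} e_φ(P) = deg φ` for all `Q`), here without identifying the constant with the
field degree. [folklore] -/
theorem fibreDegree_eq_fibreDegree_zero [IsAlgClosed k] {u w : V.FunctionField}
    (h : (V'.baseChange V.FunctionField).toAffine.Nonsingular u w) (hu : Transcendental k u)
    (Q : V'.Point) : fibreDegree V V' h hu Q = fibreDegree V V' h hu 0 := by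
  have key := eq_apply_zero_of_divisor_relations (fun Q ↦ (fibreDegree V V' h hu Q : ℤ)) ?_ ?_
    ⟨0, fun Q ↦ by positivity⟩ Q
  · exact_mod_cast key
  · intro a b hab
    have h1 := finsum_ord_mul_fibreDegree h hu (t := algebraMap V'.CoordinateRing V'.FunctionField
      (xSubC V' a)) ((map_ne_zero_iff _ (FaithfulSMul.algebraMap_injective _ _)).mpr
        (xSubC_ne_zero a))
    rw [finsum_ord_xSubC_mul _ hab] at h1
    exact h1
  · intro x₁ y₁ x₂ y₂ h₁ h₂ hx h31 h32
    have h1 := finsum_ord_mul_fibreDegree h hu (t := algebraMap V'.CoordinateRing V'.FunctionField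
      (lineFn V' x₁ y₁ (V'.slope x₁ x₂ y₁ y₂)))
      ((map_ne_zero_iff _ (FaithfulSMul.algebraMap_injective _ _)).mpr (lineFn_ne_zero _ _ _))
    rw [finsum_ord_lineFn_mul _ h₁ h₂ hx h31 h32] at h1
    exact h1

end LPoints

end Literature.NumberTheory.EllipticCurves.WeierstrassFunctionField
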